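import Mathlib
import Summits.QuantumFields.YangMills.Theorems.BalabanUVNodesN15BackgroundLayerFirstOrderMatrix
import Summits.QuantumFields.YangMills.Theorems.BalabanUVNodesN15BackgroundLayerFirstOrderFull
import HarnessLib

/-!
# Route «BalabanUVNodes» (cluster K4 «SpineRates»), Track-A DAG node N15 = spine estimate NE2, BACKGROUND LAYER — `T4EtaRate.NE2PlusOperator` BY NAME FOR
# THE NON-ABELIAN FIRST-ORDER SPECIES WITH ALL FOUR (3.42) ENTRIES OF THE BACKGROUND-DEPENDENT PAIR CONSTRUCTED, ONLY the `U ≡ 1` layer displayed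

Cell `pub-ymgap`, seat `pub-ymgap-dag-n15-c` (generation g0; R134 ACCELERATION SEAT, strategy s1; n15-b HANDOFF §g5.7 (N1) «free for n15-c»; HUMAN RULING
D-0062; chair R424 venue).  `bears_on: R4∕N15`.  Filed `--supports stmt-QuantumFields-19676` (K3; helper).  Imports this seat's M2 `…BackgroundLayerFirstOrderMatrix`
(`coeffBgM₁`, `avgM₁`, `bgInstanceM₁`, `rowLetters_of_reg335M`, `hasMaj_entry01_backgroundM₁`; M1 `unstackM`, `bgPairM`, `hasMaj_unstackM`,
`hasMaj_idef_unstackM`) and n15-b's B4 `…BackgroundLayerFirstOrderFull` (through it B3: `bgSourceV`, `bgDerivedV`, `hasMaj_idef_bgSourceV`, `hasMaj_idef_bgDerivedV`,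
`hasMaj_stack`, `hasMaj_projO_comp`, `idef_stack`, `poly0_le`, `bgConst`, `bgConst1`) BY NAME; nothing in the tree is modified.

THE POINT.  M2 read out the non-abelian first-order species with entries 2∕3 displayed; n15-b's B3 constructed entries 2∕3 over the stacked space for an
ABSTRACT perturbation `V̂` with diagonal letters — it applies VERBATIM to M1's `unstackM`.  Here (n15-b's B4 for matrix coefficients): the letters read off
`coeffBgM₁`'s `Reg335`, entries 2∕3 of the non-abelian pair under the guard, the four entry operators `bgOpsM₁4` (`𝔇(X′, X)`, `𝔇(∇′_νX′, ∇_νX)`, `𝔇(Z′, Z)` over the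
source stack `(G∇*, (∇_μG∇*)_μ)`, `𝔇(Y₃′, Y₃)` for `ΔG`), the per-index `EtaRateIneq342`, and `NE2PlusOperator` BY NAME for any family whose ONLY displayed
hypotheses are the NE2⁰ operator layer of the `U ≡ 1` pieces on the product carrier `X × ι` — (3.35) CONSUMED on every entry of every matrix coefficient.

CONTENTS ([folklore] bookkeeping; 2 defs; print SHAPES only — [Balaban1985BackgroundPropagators] Thm 3.1 (3.42) + (3.44) p. 397, (3.35) p. 396, (3.50)–(3.52)
p. 400, (3.63)–(3.65) pp. 402–403).  §1 `unstackM_letters_of_reg335M`; **`hasMaj_entry2_backgroundM₁`** (`≤ bgConst(β, c_r, m₀, c₃₅c_ι, a₀)·θ·e^{−(δ−σ)d}`,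
`c_ι = |ι|(1+|J|)`), **`hasMaj_entry3_backgroundM₁`** (`≤ bgConst1(…)·θ·e^{−(δ−σ)d}`).  §2 `bgOpsM₁4` (ALL FOUR ENTRIES CONSTRUCTED), `bgFamilyM₁4`,
**`etaRateIneq342_backgroundM₁4`** (per index, `B₀ = bgConst + bgConst1`, `δ₀ = δ − σ`), **`ne2PlusOperator_backgroundM₁4`** (`M₅ := 1`, `a₀ := (2c₃₅c_ι(βc_r+1))⁻¹`).

HONEST FRAMING ∕ LIMITS.  As M1∕M2: bookkeeping over hypothesis-shaped data; the `U ≡ 1` layer on the product carrier DISPLAYED (its inhabitant `G ⊗ 1_𝔤` is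
NOT wired here); matrix coefficients ABSTRACT (the `exp(iη ad_A)` species with the `κ_e` letters of parts 13b∕16∕18 is the sequel); `ι` nonempty; nothing about
Bałaban's `G(U)` asserted.  NE2⁺ NOT PRINTED, NOT proved; count-neutral (typed 28∕28; nothing discharged); N15 NOT discharged; one finite lattice at fixed ε —
NOT infinite volume, NOT OS on ℝ⁴, NOT a mass gap, NOT Clay.
-/

noncomputable section
namespace Summit.QuantumFields.YangMills.BalabanUVNodes.N15.BackgroundLayer

open Literature.MathematicalPhysics.QuantumFieldTheory.Balaban1983to89
open Literature.MathematicalPhysics.QuantumFieldTheory.Balaban1983to89.B11SectG (BlockNorm HasMaj RowSum)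
open Literature.MathematicalPhysics.QuantumFieldTheory.Balaban1983to89.T4EtaRate (PairedInstance EtaRateIneq342 NE2PlusOperator rateFactor)
open Literature.MathematicalPhysics.QuantumFieldTheory.Balaban1983to89.T4EtaRateDefect (idef rateWeight)
open Literature.MathematicalPhysics.QuantumFieldTheory.Balaban1983to89.T4EtaRateCoeffDefect (pull diagK FibreOsc blockAvg fit_blockAvg)
open Literature.MathematicalPhysics.QuantumFieldTheory.Balaban1983to89.B6RandomWalk (Triangle254)
open Literature.MathematicalPhysics.QuantumFieldTheory.Balaban1983to89.B9SectDSup (inv_one_sub_le_two)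
open Summit.QuantumFields.YangMills.BalabanUVNodes.N15.OperatorReadout (opGeo opFamily opGeo_len rateFactor_opGeo etaRateIneq342_of_hasMaj)
open Summit.QuantumFields.YangMills.BalabanUVNodes.N15.MatrixSpecies (liftMap liftBlk)

/-! ## §1 The non-abelian first-order pair under the guard: letters read off `Reg335`, entries 2 and 3 -/

section Guard

variable {X X' J ι : Type} [Fintype X] [Fintype X'] [Fintype J] [Fintype ι] [DecidableEq X] [DecidableEq X'] [DecidableEq J] [DecidableEq ι]
  {g : B6.Geometry} (blk : X → g.Site) (π : X' → X)
variable {G S D₃ : (X × ι → ℝ) →ₗ[ℝ] (X × ι → ℝ)} {D SD : J → (X × ι → ℝ) →ₗ[ℝ] (X × ι → ℝ)} {G' S' D₃' : (X' × ι → ℝ) →ₗ[ℝ] (X' × ι → ℝ)}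
  {D' SD' : J → (X' × ι → ℝ) →ₗ[ℝ] (X' × ι → ℝ)}

omit [DecidableEq X'] [DecidableEq J] [DecidableEq ι] in
/-- The letters of a `Reg335`-regular matrix coefficient family under the guard: row letter `r′ = c₃₅Mα₀|ι|`, stacked bound `R = r′(1+|J|) ≤ c₃₅·c_ι·a₀`,
contraction `q ≤ ½`, and the majorants∕defect of the unstacked matrix perturbations at both spacings. [cite: Balaban1985BackgroundPropagators, Thm 3.1 p.397 (quantifier template); (3.35) p.396 (shape)] -/
theorem unstackM_letters_of_reg335M {β cr θ c35 a₀ M α₀ : ℝ} (hcr : 0 ≤ cr) (hβ : 0 ≤ β) (hθ : 0 ≤ θ) (hc35 : 0 < c35)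
    (hq : β * (c35 * (Fintype.card ι * (1 + Fintype.card J)) * a₀) * cr ≤ 1 / 2) (hM : 1 ≤ M) (hMα : M * α₀ ≤ a₀) (hα₀ : 0 < α₀)
    {U : (X' → Matrix ι ι ℝ) × (J → X' → Matrix ι ι ℝ)} (hreg : (coeffBgM₁ J ι π M θ).Reg335 c35 α₀ U) :
    0 ≤ c35 * M * α₀ * Fintype.card ι * (1 + Fintype.card J) ∧
      c35 * M * α₀ * Fintype.card ι * (1 + Fintype.card J) ≤ c35 * (Fintype.card ι * (1 + Fintype.card J)) * a₀ ∧
      β * (c35 * M * α₀ * Fintype.card ι * (1 + Fintype.card J)) * cr < 1 ∧ (1 - β * (c35 * M * α₀ * Fintype.card ι * (1 + Fintype.card J)) * cr)⁻¹ ≤ 2 ∧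
      HasMaj (BlockNorm.ofBlocks g (blkPair (liftBlk blk ι))) (BlockNorm.ofBlocks g (liftBlk blk ι)) (unstackM (avgM₁ J ι π U).1 (avgM₁ J ι π U).2)
        (diagK fun _ => c35 * M * α₀ * Fintype.card ι * (1 + Fintype.card J)) ∧
      HasMaj (BlockNorm.ofBlocks g (blkPair (liftBlk (blk ∘ π) ι))) (BlockNorm.ofBlocks g (liftBlk (blk ∘ π) ι)) (unstackM U.1 U.2)
        (diagK fun _ => c35 * M * α₀ * Fintype.card ι * (1 + Fintype.card J)) ∧
      HasMaj (BlockNorm.ofBlocks g (blkPair (liftBlk blk ι))) (BlockNorm.ofBlocks g (liftBlk (blk ∘ π) ι))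
        (idef (pull (liftPair (liftMap π ι))) (pull (liftMap π ι)) (unstackM U.1 U.2) (unstackM (avgM₁ J ι π U).1 (avgM₁ J ι π U).2))
        (diagK fun _ => c35 * M * α₀ * Fintype.card ι * θ * (1 + Fintype.card J)) := by
  set r : ℝ := c35 * M * α₀ with hr_def
  have hι0 : (0 : ℝ) ≤ Fintype.card ι := Nat.cast_nonneg _
  have hJ0 : (0 : ℝ) ≤ 1 + Fintype.card J := by positivity
  have hM0 : 0 ≤ M := zero_le_one.trans hM
  have hr0 : 0 ≤ r := by positivity
  have hr'0 : 0 ≤ r * Fintype.card ι := mul_nonneg hr0 hι0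
  have hra : r ≤ c35 * a₀ := by rw [hr_def, mul_assoc]; exact mul_le_mul_of_nonneg_left hMα hc35.le
  have hRa : r * Fintype.card ι * (1 + Fintype.card J) ≤ c35 * (Fintype.card ι * (1 + Fintype.card J)) * a₀ := by
    calc r * Fintype.card ι * (1 + Fintype.card J) = r * (Fintype.card ι * (1 + Fintype.card J)) := by ring
      _ ≤ c35 * a₀ * (Fintype.card ι * (1 + Fintype.card J)) := mul_le_mul_of_nonneg_right hra (mul_nonneg hι0 hJ0)
      _ = c35 * (Fintype.card ι * (1 + Fintype.card J)) * a₀ := by ring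
  have hq' : β * (r * Fintype.card ι * (1 + Fintype.card J)) * cr ≤ 1 / 2 :=
    (mul_le_mul_of_nonneg_right (mul_le_mul_of_nonneg_left hRa hβ) hcr).trans hq
  obtain ⟨hc, ha, hc', ha', hfc, hfa⟩ := rowLetters_of_reg335M (J := J) (ι := ι) π hr0 hreg
  refine ⟨mul_nonneg hr'0 hJ0, hRa, by linarith, inv_one_sub_le_two hq', hasMaj_unstackM blk hr'0 hc ha, hasMaj_unstackM (blk ∘ π) hr'0 hc' ha', ?_⟩
  exact hasMaj_idef_unstackM blk π (mul_nonneg hr'0 hθ) hfc hfa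

/-- **ENTRY 2 OF THE NON-ABELIAN FIRST-ORDER PAIR UNDER THE GUARD**: with the `U ≡ 1` source stack `Ŝ = stack S SD` on the product carrier (`S = G∇*`,
`SD_μ = ∇_μG∇*`), majorants `β·e^{−δd}` and defects `m₀·θ·e^{−δd}`: `𝔇(Z′(U), Z(Ū)) ≤ bgConst(β, c_r, m₀, c₃₅c_ι, a₀)·θ·e^{−(δ−σ)d}` for every regular `U` under
the guard. [cite: Balaban1985BackgroundPropagators, Thm 3.1 (3.42)₃ + (3.44) p.397 (shapes); (3.63)–(3.65) pp.402–403 (mechanism)] -/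
theorem hasMaj_entry2_backgroundM₁ (htri : Triangle254 g) (hd : ∀ a b : g.Site, 0 ≤ g.dist a b) {σ cr : ℝ} (hσ : 0 ≤ σ) (hcr : 0 ≤ cr)
    (hrow : RowSum g σ cr) {δ β m₀ θ c35 a₀ M α₀ : ℝ} (hσδ : σ ≤ δ) (hβ : 0 ≤ β) (hm₀ : 0 ≤ m₀) (hθ : 0 ≤ θ) (hc35 : 0 < c35)
    (hq : β * (c35 * (Fintype.card ι * (1 + Fintype.card J)) * a₀) * cr ≤ 1 / 2) (hM : 1 ≤ M) (hα₀ : 0 < α₀) (hMα : M * α₀ ≤ a₀)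
    (hG : HasMaj (BlockNorm.ofBlocks g (liftBlk blk ι)) (BlockNorm.ofBlocks g (liftBlk blk ι)) G (fun y y' => β * Real.exp (-(δ * g.dist y y'))))
    (hD : ∀ μ, HasMaj (BlockNorm.ofBlocks g (liftBlk blk ι)) (BlockNorm.ofBlocks g (liftBlk blk ι)) (D μ)
      (fun y y' => β * Real.exp (-(δ * g.dist y y'))))
    (hG' : HasMaj (BlockNorm.ofBlocks g (liftBlk (blk ∘ π) ι)) (BlockNorm.ofBlocks g (liftBlk (blk ∘ π) ι)) G'
      (fun y y' => β * Real.exp (-(δ * g.dist y y'))))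
    (hD' : ∀ μ, HasMaj (BlockNorm.ofBlocks g (liftBlk (blk ∘ π) ι)) (BlockNorm.ofBlocks g (liftBlk (blk ∘ π) ι)) (D' μ)
      (fun y y' => β * Real.exp (-(δ * g.dist y y'))))
    (hS : HasMaj (BlockNorm.ofBlocks g (liftBlk blk ι)) (BlockNorm.ofBlocks g (liftBlk blk ι)) S (fun y y' => β * Real.exp (-(δ * g.dist y y'))))
    (hSD : ∀ μ, HasMaj (BlockNorm.ofBlocks g (liftBlk blk ι)) (BlockNorm.ofBlocks g (liftBlk blk ι)) (SD μ)
      (fun y y' => β * Real.exp (-(δ * g.dist y y'))))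
    (hDG : HasMaj (BlockNorm.ofBlocks g (liftBlk blk ι)) (BlockNorm.ofBlocks g (liftBlk (blk ∘ π) ι))
      (idef (pull (liftMap π ι)) (pull (liftMap π ι)) G' G) (fun y y' => m₀ * θ * Real.exp (-(δ * g.dist y y'))))
    (hDD : ∀ μ, HasMaj (BlockNorm.ofBlocks g (liftBlk blk ι)) (BlockNorm.ofBlocks g (liftBlk (blk ∘ π) ι))
      (idef (pull (liftMap π ι)) (pull (liftMap π ι)) (D' μ) (D μ)) (fun y y' => m₀ * θ * Real.exp (-(δ * g.dist y y'))))
    (hDS : HasMaj (BlockNorm.ofBlocks g (liftBlk blk ι)) (BlockNorm.ofBlocks g (liftBlk (blk ∘ π) ι))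
      (idef (pull (liftMap π ι)) (pull (liftMap π ι)) S' S) (fun y y' => m₀ * θ * Real.exp (-(δ * g.dist y y'))))
    (hDSD : ∀ μ, HasMaj (BlockNorm.ofBlocks g (liftBlk blk ι)) (BlockNorm.ofBlocks g (liftBlk (blk ∘ π) ι))
      (idef (pull (liftMap π ι)) (pull (liftMap π ι)) (SD' μ) (SD μ)) (fun y y' => m₀ * θ * Real.exp (-(δ * g.dist y y'))))
    {U : (X' → Matrix ι ι ℝ) × (J → X' → Matrix ι ι ℝ)} (hreg : (coeffBgM₁ J ι π M θ).Reg335 c35 α₀ U) :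
    HasMaj (BlockNorm.ofBlocks g (liftBlk blk ι)) (BlockNorm.ofBlocks g (blkPair (liftBlk (blk ∘ π) ι)))
      (idef (pull (liftMap π ι)) (pull (liftPair (liftMap π ι))) (bgSourceV (stack G' D') (stack S' SD') (unstackM U.1 U.2))
        (bgSourceV (stack G D) (stack S SD) (unstackM (avgM₁ J ι π U).1 (avgM₁ J ι π U).2)))
      (fun y y' => bgConst β cr m₀ (c35 * (Fintype.card ι * (1 + Fintype.card J))) a₀ * θ * Real.exp (-((δ - σ) * g.dist y y'))) := by
  obtain ⟨hR0, hRa, hq1, hinv, hV, hV', hDV⟩ := unstackM_letters_of_reg335M (g := g) blk π hcr hβ hθ hc35 hq hM hMα hα₀ hreg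
  have hinv0 : 0 ≤ (1 - β * (c35 * M * α₀ * Fintype.card ι * (1 + Fintype.card J)) * cr)⁻¹ := inv_nonneg.2 (by linarith)
  have hβe : ∀ y y' : g.Site, 0 ≤ β * Real.exp (-(δ * g.dist y y')) := fun _ _ => mul_nonneg hβ (Real.exp_nonneg _)
  have hme : ∀ y y' : g.Site, 0 ≤ m₀ * θ * Real.exp (-(δ * g.dist y y')) := fun _ _ => mul_nonneg (mul_nonneg hm₀ hθ) (Real.exp_nonneg _)
  have hSG := hasMaj_stack (liftBlk blk ι) hβe hG hD
  have hSG' := hasMaj_stack (liftBlk (blk ∘ π) ι) hβe hG' hD'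
  have hSS := hasMaj_stack (liftBlk blk ι) hβe hS hSD
  have hSDG : HasMaj (BlockNorm.ofBlocks g (liftBlk blk ι)) (BlockNorm.ofBlocks g (blkPair (liftBlk (blk ∘ π) ι)))
      (idef (pull (liftMap π ι)) (pull (liftPair (liftMap π ι))) (stack G' D') (stack G D)) (fun y y' => m₀ * θ * Real.exp (-(δ * g.dist y y'))) := by
    rw [idef_stack]; exact hasMaj_stack (liftBlk (blk ∘ π) ι) hme hDG hDD
  have hSDS : HasMaj (BlockNorm.ofBlocks g (liftBlk blk ι)) (BlockNorm.ofBlocks g (blkPair (liftBlk (blk ∘ π) ι)))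
      (idef (pull (liftMap π ι)) (pull (liftPair (liftMap π ι))) (stack S' SD') (stack S SD)) (fun y y' => m₀ * θ * Real.exp (-(δ * g.dist y y'))) := by
    rw [idef_stack]; exact hasMaj_stack (liftBlk (blk ∘ π) ι) hme hDS hDSD
  have hθ' : 0 ≤ c35 * M * α₀ * Fintype.card ι * θ * (1 + Fintype.card J) := by
    have : 0 ≤ c35 * M * α₀ * Fintype.card ι * (1 + Fintype.card J) := hR0
    nlinarith
  have key := hasMaj_idef_bgSourceV (liftBlk blk ι) (blkPair (liftBlk blk ι)) (liftMap π ι) (liftPair (liftMap π ι)) htri hd hσ hcr hrow (ρ := δ - σ)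
    (by linarith) (by linarith) hβ hR0 hθ' (mul_nonneg hm₀ hθ) (mul_nonneg hm₀ hθ) hSG hSG' hSS hSDG hSDS hV hV' hDV hq1
  refine key.mono fun a b => ?_
  simp only [one_mul, mul_one]
  refine mul_le_mul_of_nonneg_right ?_ (Real.exp_nonneg _)
  have hpoly := poly0_le (β := β) (cr := cr) (m₀ := m₀) (θ := θ) (c35 := c35 * (Fintype.card ι * (1 + Fintype.card J))) (a₀ := a₀)
    (r := c35 * M * α₀ * Fintype.card ι * (1 + Fintype.card J)) (u := (1 - β * (c35 * M * α₀ * Fintype.card ι * (1 + Fintype.card J)) * cr)⁻¹)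
    hβ hcr hm₀ hθ hR0 hRa hinv0 hinv
  have heq : c35 * M * α₀ * Fintype.card ι * θ * (1 + Fintype.card J) = c35 * M * α₀ * Fintype.card ι * (1 + Fintype.card J) * θ := by ring
  rw [heq]
  exact hpoly

/-- **ENTRY 3 OF THE NON-ABELIAN FIRST-ORDER PAIR UNDER THE GUARD**: with the `U ≡ 1` derived pair `D₃, D₃′` (`ΔG`) on the product carrier, `D₃′ ≤ β·e^{−δd}`,
`𝔇(D₃′, D₃) ≤ m₀·θ·e^{−δd}`: `𝔇(bgDerivedV Ĝ′ D₃′ V̂′(U), bgDerivedV Ĝ D₃ V̂(Ū)) ≤ bgConst1(β, c_r, m₀, c₃₅c_ι, a₀)·θ·e^{−(δ−σ)d}` for every regular `U` under the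
guard. [cite: Balaban1985BackgroundPropagators, Thm 3.1 (3.42)₄ p.397 (shape); King1986, Prop. 3.9 (3.73) p.665 (shape)] -/
theorem hasMaj_entry3_backgroundM₁ (htri : Triangle254 g) (hd : ∀ a b : g.Site, 0 ≤ g.dist a b) {σ cr : ℝ} (hσ : 0 ≤ σ) (hcr : 0 ≤ cr)
    (hrow : RowSum g σ cr) {δ β m₀ θ c35 a₀ M α₀ : ℝ} (hσδ : σ ≤ δ) (hβ : 0 ≤ β) (hm₀ : 0 ≤ m₀) (hθ : 0 ≤ θ) (hc35 : 0 < c35) (ha₀ : 0 ≤ a₀)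
    (hq : β * (c35 * (Fintype.card ι * (1 + Fintype.card J)) * a₀) * cr ≤ 1 / 2) (hM : 1 ≤ M) (hα₀ : 0 < α₀) (hMα : M * α₀ ≤ a₀)
    (hG : HasMaj (BlockNorm.ofBlocks g (liftBlk blk ι)) (BlockNorm.ofBlocks g (liftBlk blk ι)) G (fun y y' => β * Real.exp (-(δ * g.dist y y'))))
    (hD : ∀ μ, HasMaj (BlockNorm.ofBlocks g (liftBlk blk ι)) (BlockNorm.ofBlocks g (liftBlk blk ι)) (D μ)
      (fun y y' => β * Real.exp (-(δ * g.dist y y'))))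
    (hG' : HasMaj (BlockNorm.ofBlocks g (liftBlk (blk ∘ π) ι)) (BlockNorm.ofBlocks g (liftBlk (blk ∘ π) ι)) G'
      (fun y y' => β * Real.exp (-(δ * g.dist y y'))))
    (hD' : ∀ μ, HasMaj (BlockNorm.ofBlocks g (liftBlk (blk ∘ π) ι)) (BlockNorm.ofBlocks g (liftBlk (blk ∘ π) ι)) (D' μ)
      (fun y y' => β * Real.exp (-(δ * g.dist y y'))))
    (hD₃' : HasMaj (BlockNorm.ofBlocks g (liftBlk (blk ∘ π) ι)) (BlockNorm.ofBlocks g (liftBlk (blk ∘ π) ι)) D₃'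
      (fun y y' => β * Real.exp (-(δ * g.dist y y'))))
    (hDG : HasMaj (BlockNorm.ofBlocks g (liftBlk blk ι)) (BlockNorm.ofBlocks g (liftBlk (blk ∘ π) ι))
      (idef (pull (liftMap π ι)) (pull (liftMap π ι)) G' G) (fun y y' => m₀ * θ * Real.exp (-(δ * g.dist y y'))))
    (hDD : ∀ μ, HasMaj (BlockNorm.ofBlocks g (liftBlk blk ι)) (BlockNorm.ofBlocks g (liftBlk (blk ∘ π) ι))
      (idef (pull (liftMap π ι)) (pull (liftMap π ι)) (D' μ) (D μ)) (fun y y' => m₀ * θ * Real.exp (-(δ * g.dist y y'))))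
    (hDD₃ : HasMaj (BlockNorm.ofBlocks g (liftBlk blk ι)) (BlockNorm.ofBlocks g (liftBlk (blk ∘ π) ι))
      (idef (pull (liftMap π ι)) (pull (liftMap π ι)) D₃' D₃) (fun y y' => m₀ * θ * Real.exp (-(δ * g.dist y y'))))
    {U : (X' → Matrix ι ι ℝ) × (J → X' → Matrix ι ι ℝ)} (hreg : (coeffBgM₁ J ι π M θ).Reg335 c35 α₀ U) :
    HasMaj (BlockNorm.ofBlocks g (liftBlk blk ι)) (BlockNorm.ofBlocks g (liftBlk (blk ∘ π) ι))
      (idef (pull (liftMap π ι)) (pull (liftMap π ι)) (bgDerivedV (stack G' D') D₃' (unstackM U.1 U.2))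
        (bgDerivedV (stack G D) D₃ (unstackM (avgM₁ J ι π U).1 (avgM₁ J ι π U).2)))
      (fun y y' => bgConst1 β cr m₀ (c35 * (Fintype.card ι * (1 + Fintype.card J))) a₀ * θ * Real.exp (-((δ - σ) * g.dist y y'))) := by
  obtain ⟨hR0, hRa, hq1, hinv, hV, hV', hDV⟩ := unstackM_letters_of_reg335M (g := g) blk π hcr hβ hθ hc35 hq hM hMα hα₀ hreg
  set R : ℝ := c35 * M * α₀ * Fintype.card ι * (1 + Fintype.card J) with hR_def
  have hq'' : β * R * cr ≤ 1 / 2 := (mul_le_mul_of_nonneg_right (mul_le_mul_of_nonneg_left hRa hβ) hcr).trans hq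
  have hinv0 : 0 ≤ (1 - β * R * cr)⁻¹ := inv_nonneg.2 (by linarith)
  have hβe : ∀ y y' : g.Site, 0 ≤ β * Real.exp (-(δ * g.dist y y')) := fun _ _ => mul_nonneg hβ (Real.exp_nonneg _)
  have hme : ∀ y y' : g.Site, 0 ≤ m₀ * θ * Real.exp (-(δ * g.dist y y')) := fun _ _ => mul_nonneg (mul_nonneg hm₀ hθ) (Real.exp_nonneg _)
  have hSG := hasMaj_stack (liftBlk blk ι) hβe hG hD
  have hSG' := hasMaj_stack (liftBlk (blk ∘ π) ι) hβe hG' hD'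
  have hSDG : HasMaj (BlockNorm.ofBlocks g (liftBlk blk ι)) (BlockNorm.ofBlocks g (blkPair (liftBlk (blk ∘ π) ι)))
      (idef (pull (liftMap π ι)) (pull (liftPair (liftMap π ι))) (stack G' D') (stack G D)) (fun y y' => m₀ * θ * Real.exp (-(δ * g.dist y y'))) := by
    rw [idef_stack]; exact hasMaj_stack (liftBlk (blk ∘ π) ι) hme hDG hDD
  have hθ' : 0 ≤ c35 * M * α₀ * Fintype.card ι * θ * (1 + Fintype.card J) := by
    have : 0 ≤ c35 * M * α₀ * Fintype.card ι * (1 + Fintype.card J) := hR0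
    nlinarith
  have key := hasMaj_idef_bgDerivedV (liftBlk blk ι) (blkPair (liftBlk blk ι)) (liftMap π ι) (liftPair (liftMap π ι)) htri hd hσ hcr hrow (ρ := δ - σ)
    (by linarith) (by linarith) hβ hR0 hθ' (mul_nonneg hm₀ hθ) (mul_nonneg hm₀ hθ) hSG hSG' hD₃' hSDG hDD₃ hV hV' hDV hq1
  refine key.mono fun a b => ?_
  simp only [one_mul]
  refine mul_le_mul_of_nonneg_right ?_ (Real.exp_nonneg _)
  have heq : c35 * M * α₀ * Fintype.card ι * θ * (1 + Fintype.card J) = R * θ := by rw [hR_def]; ring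
  rw [heq]
  set u : ℝ := (1 - β * R * cr)⁻¹ with hu_def
  have h0 := poly0_le (β := β) (cr := cr) (m₀ := m₀) (θ := θ) (c35 := c35 * (Fintype.card ι * (1 + Fintype.card J))) (a₀ := a₀) (r := R) (u := u)
    hβ hcr hm₀ hθ hR0 hRa hinv0 hinv
  have h2 : m₀ * θ * cr * (R * (β * u)) ≤ m₀ * θ * cr * (c35 * (Fintype.card ι * (1 + Fintype.card J)) * a₀ * (β * 2)) := by gcongr
  have h3 : β * R * cr * ((m₀ * θ * cr + m₀ * θ * cr * (R * (β * u)) + β * (R * θ) * (β * u) * cr) * u) ≤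
      1 / 2 * (bgConst β cr m₀ (c35 * (Fintype.card ι * (1 + Fintype.card J))) a₀ * θ) := mul_le_mul hq'' h0 (by positivity) (by norm_num)
  have h4 : β * (R * θ) * (β * u) * cr ≤ β * (c35 * (Fintype.card ι * (1 + Fintype.card J)) * a₀ * θ) * (β * 2) * cr := by gcongr
  calc m₀ * θ * cr + m₀ * θ * cr * (R * (β * u)) +
        β * R * cr * ((m₀ * θ * cr + m₀ * θ * cr * (R * (β * u)) + β * (R * θ) * (β * u) * cr) * u) + β * (R * θ) * (β * u) * cr
      ≤ m₀ * θ * cr + m₀ * θ * cr * (c35 * (Fintype.card ι * (1 + Fintype.card J)) * a₀ * (β * 2)) +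
        1 / 2 * (bgConst β cr m₀ (c35 * (Fintype.card ι * (1 + Fintype.card J))) a₀ * θ) +
          β * (c35 * (Fintype.card ι * (1 + Fintype.card J)) * a₀ * θ) * (β * 2) * cr :=
        add_le_add (add_le_add (add_le_add le_rfl h2) h3) h4
    _ = bgConst1 β cr m₀ (c35 * (Fintype.card ι * (1 + Fintype.card J))) a₀ * θ := by unfold bgConst1; ring

end Guard
/-! ## §2 All four entries of the non-abelian first-order pair: the kernel family, `EtaRateIneq342` per index, `NE2PlusOperator` BY NAME -/

section Readout

variable {X X' J ι : Type} [Fintype X] [Fintype X'] [Fintype J] [Fintype ι] [DecidableEq X] [DecidableEq X'] [DecidableEq J] [DecidableEq ι] [Nonempty ι]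
  {g : B6.Geometry} (blk : X → g.Site) (π : X' → X)

/-- THE FOUR ENTRY OPERATORS OF THE NON-ABELIAN FIRST-ORDER BACKGROUND-DEPENDENT PAIR, ALL CONSTRUCTED: entry 0 ∕ 1 = the `none` ∕ `some ν` components of `bgPairM`,
entry 2 = the source step over the stacks with the source stack `(S, SD_μ)`, entry 3 = the derived object of `D₃`; coarse coefficients = entrywise block averages.
[cite: Balaban1985BackgroundPropagators, (3.42) p.397 (the four entries: shape)] -/
def bgOpsM₁4 (ν : J) (G S D₃ : (X × ι → ℝ) →ₗ[ℝ] (X × ι → ℝ)) (D SD : J → (X × ι → ℝ) →ₗ[ℝ] (X × ι → ℝ))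
    (G' S' D₃' : (X' × ι → ℝ) →ₗ[ℝ] (X' × ι → ℝ)) (D' SD' : J → (X' × ι → ℝ) →ₗ[ℝ] (X' × ι → ℝ)) :
    Fin 4 → (X' → Matrix ι ι ℝ) × (J → X' → Matrix ι ι ℝ) → ((X × ι → ℝ) →ₗ[ℝ] (X' × ι → ℝ)) :=
  fun n U => ![idef (pull (liftMap π ι)) (pull (liftMap π ι)) (projO none ∘ₗ bgPairM G' D' U.1 U.2)
      (projO none ∘ₗ bgPairM G D (avgM₁ J ι π U).1 (avgM₁ J ι π U).2),
    idef (pull (liftMap π ι)) (pull (liftMap π ι)) (projO (some ν) ∘ₗ bgPairM G' D' U.1 U.2)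
      (projO (some ν) ∘ₗ bgPairM G D (avgM₁ J ι π U).1 (avgM₁ J ι π U).2),
    idef (pull (liftMap π ι)) (pull (liftMap π ι)) (projO none ∘ₗ bgSourceV (stack G' D') (stack S' SD') (unstackM U.1 U.2))
      (projO none ∘ₗ bgSourceV (stack G D) (stack S SD) (unstackM (avgM₁ J ι π U).1 (avgM₁ J ι π U).2)),
    idef (pull (liftMap π ι)) (pull (liftMap π ι)) (bgDerivedV (stack G' D') D₃' (unstackM U.1 U.2))
      (bgDerivedV (stack G D) D₃ (unstackM (avgM₁ J ι π U).1 (avgM₁ J ι π U).2))] n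

/-- THE KERNEL FAMILY over the matrix coefficient carrier with all four entries constructed. [cite: Balaban1985BackgroundPropagators, (3.42) p.397 (shape)] -/
def bgFamilyM₁4 (n : ℕ) (hL : g.L ≠ 0) (θc θ : ℝ) (ν : J) (G S D₃ : (X × ι → ℝ) →ₗ[ℝ] (X × ι → ℝ)) (D SD : J → (X × ι → ℝ) →ₗ[ℝ] (X × ι → ℝ))
    (G' S' D₃' : (X' × ι → ℝ) →ₗ[ℝ] (X' × ι → ℝ)) (D' SD' : J → (X' × ι → ℝ) →ₗ[ℝ] (X' × ι → ℝ)) :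
    B9.KernelFamily (bgInstanceM₁ J ι blk π n hL θc θ).gc (bgInstanceM₁ J ι blk π n hL θc θ).Bf :=
  show B9.KernelFamily (opGeo g (X × ι) (liftBlk blk ι)) (coeffBgM₁ J ι π g.M θ) from
    opFamily (g := g) (B := coeffBgM₁ J ι π g.M θ) (liftBlk blk ι) (liftBlk (blk ∘ π) ι) (bgOpsM₁4 π ν G S D₃ D SD G' S' D₃' D' SD')

variable {G S D₃ : (X × ι → ℝ) →ₗ[ℝ] (X × ι → ℝ)} {D SD : J → (X × ι → ℝ) →ₗ[ℝ] (X × ι → ℝ)} {G' S' D₃' : (X' × ι → ℝ) →ₗ[ℝ] (X' × ι → ℝ)}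
  {D' SD' : J → (X' × ι → ℝ) →ₗ[ℝ] (X' × ι → ℝ)}

/-- **`EtaRateIneq342` PER INDEX, NON-ABELIAN FIRST-ORDER SPECIES, ALL FOUR ENTRIES CONSTRUCTED, EXPLICIT CONSTANTS** (`B₀ = bgConst(…) + bgConst1(…)`, `δ₀ = δ − σ`).
[cite: Balaban1985BackgroundPropagators, Thm 3.1 (3.42) p.397 (shape, quantifier template)] -/
theorem etaRateIneq342_backgroundM₁4 (htri : Triangle254 g) (hd : ∀ a b : g.Site, 0 ≤ g.dist a b) {σ cr : ℝ} (hσ : 0 ≤ σ) (hcr : 0 ≤ cr)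
    (hrow : RowSum g σ cr) (hη : 0 < g.eta) (hL : 0 < g.L) (hlen : ∀ y, 1 ≤ g.len y) {δ β m₀ θ c35 a₀ M α₀ γ : ℝ}
    (hσδ : σ ≤ δ) (hβ : 0 ≤ β) (hm₀ : 0 ≤ m₀) (hθ : 0 ≤ θ) (hθγ : ∀ y, θ ≤ rateWeight g γ y) (hc35 : 0 < c35) (ha₀ : 0 ≤ a₀)
    (hq : β * (c35 * (Fintype.card ι * (1 + Fintype.card J)) * a₀) * cr ≤ 1 / 2) (hM : 1 ≤ M) (hα₀ : 0 < α₀) (hMα : M * α₀ ≤ a₀) {ν : J}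
    (hG : HasMaj (BlockNorm.ofBlocks g (liftBlk blk ι)) (BlockNorm.ofBlocks g (liftBlk blk ι)) G (fun y y' => β * Real.exp (-(δ * g.dist y y'))))
    (hD : ∀ μ, HasMaj (BlockNorm.ofBlocks g (liftBlk blk ι)) (BlockNorm.ofBlocks g (liftBlk blk ι)) (D μ)
      (fun y y' => β * Real.exp (-(δ * g.dist y y'))))
    (hG' : HasMaj (BlockNorm.ofBlocks g (liftBlk (blk ∘ π) ι)) (BlockNorm.ofBlocks g (liftBlk (blk ∘ π) ι)) G'
      (fun y y' => β * Real.exp (-(δ * g.dist y y'))))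
    (hD' : ∀ μ, HasMaj (BlockNorm.ofBlocks g (liftBlk (blk ∘ π) ι)) (BlockNorm.ofBlocks g (liftBlk (blk ∘ π) ι)) (D' μ)
      (fun y y' => β * Real.exp (-(δ * g.dist y y'))))
    (hS : HasMaj (BlockNorm.ofBlocks g (liftBlk blk ι)) (BlockNorm.ofBlocks g (liftBlk blk ι)) S (fun y y' => β * Real.exp (-(δ * g.dist y y'))))
    (hSD : ∀ μ, HasMaj (BlockNorm.ofBlocks g (liftBlk blk ι)) (BlockNorm.ofBlocks g (liftBlk blk ι)) (SD μ)
      (fun y y' => β * Real.exp (-(δ * g.dist y y'))))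
    (hD₃' : HasMaj (BlockNorm.ofBlocks g (liftBlk (blk ∘ π) ι)) (BlockNorm.ofBlocks g (liftBlk (blk ∘ π) ι)) D₃'
      (fun y y' => β * Real.exp (-(δ * g.dist y y'))))
    (hDG : HasMaj (BlockNorm.ofBlocks g (liftBlk blk ι)) (BlockNorm.ofBlocks g (liftBlk (blk ∘ π) ι))
      (idef (pull (liftMap π ι)) (pull (liftMap π ι)) G' G) (fun y y' => m₀ * θ * Real.exp (-(δ * g.dist y y'))))
    (hDD : ∀ μ, HasMaj (BlockNorm.ofBlocks g (liftBlk blk ι)) (BlockNorm.ofBlocks g (liftBlk (blk ∘ π) ι))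
      (idef (pull (liftMap π ι)) (pull (liftMap π ι)) (D' μ) (D μ)) (fun y y' => m₀ * θ * Real.exp (-(δ * g.dist y y'))))
    (hDS : HasMaj (BlockNorm.ofBlocks g (liftBlk blk ι)) (BlockNorm.ofBlocks g (liftBlk (blk ∘ π) ι))
      (idef (pull (liftMap π ι)) (pull (liftMap π ι)) S' S) (fun y y' => m₀ * θ * Real.exp (-(δ * g.dist y y'))))
    (hDSD : ∀ μ, HasMaj (BlockNorm.ofBlocks g (liftBlk blk ι)) (BlockNorm.ofBlocks g (liftBlk (blk ∘ π) ι))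
      (idef (pull (liftMap π ι)) (pull (liftMap π ι)) (SD' μ) (SD μ)) (fun y y' => m₀ * θ * Real.exp (-(δ * g.dist y y'))))
    (hDD₃ : HasMaj (BlockNorm.ofBlocks g (liftBlk blk ι)) (BlockNorm.ofBlocks g (liftBlk (blk ∘ π) ι))
      (idef (pull (liftMap π ι)) (pull (liftMap π ι)) D₃' D₃) (fun y y' => m₀ * θ * Real.exp (-(δ * g.dist y y'))))
    {U : (X' → Matrix ι ι ℝ) × (J → X' → Matrix ι ι ℝ)} (hreg : (coeffBgM₁ J ι π M θ).Reg335 c35 α₀ U) :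
    EtaRateIneq342 (opFamily (g := g) (B := coeffBgM₁ J ι π M θ) (liftBlk blk ι) (liftBlk (blk ∘ π) ι) (bgOpsM₁4 π ν G S D₃ D SD G' S' D₃' D' SD'))
      (bgConst β cr m₀ (c35 * (Fintype.card ι * (1 + Fintype.card J))) a₀ + bgConst1 β cr m₀ (c35 * (Fintype.card ι * (1 + Fintype.card J))) a₀)
      (δ - σ) γ U := by
  have hcι : (0 : ℝ) ≤ c35 * (Fintype.card ι * (1 + Fintype.card J)) := by positivity
  have h01 := hasMaj_entry01_backgroundM₁ blk π htri hd hσ hcr hrow hσδ hβ hm₀ hθ hc35 hq hM hα₀ hMα hG hD hG' hD' hDG hDD hreg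
  have h2 := hasMaj_entry2_backgroundM₁ blk π htri hd hσ hcr hrow hσδ hβ hm₀ hθ hc35 hq hM hα₀ hMα hG hD hG' hD' hS hSD hDG hDD hDS hDSD hreg
  have h3 := hasMaj_entry3_backgroundM₁ blk π htri hd hσ hcr hrow hσδ hβ hm₀ hθ hc35 ha₀ hq hM hα₀ hMα hG hD hG' hD' hD₃' hDG hDD hDD₃ hreg
  have hC0 : 0 ≤ bgConst β cr m₀ (c35 * (Fintype.card ι * (1 + Fintype.card J))) a₀ := bgConst_nonneg hβ hcr hm₀ hcι ha₀
  have hC1 : 0 ≤ bgConst1 β cr m₀ (c35 * (Fintype.card ι * (1 + Fintype.card J))) a₀ := bgConst1_nonneg hβ hcr hm₀ hcι ha₀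
  set B₀ : ℝ := bgConst β cr m₀ (c35 * (Fintype.card ι * (1 + Fintype.card J))) a₀ + bgConst1 β cr m₀ (c35 * (Fintype.card ι * (1 + Fintype.card J))) a₀
    with hB₀_def
  have hB₀ : 0 ≤ B₀ := add_nonneg hC0 hC1
  refine etaRateIneq342_of_hasMaj (g := g) (B := coeffBgM₁ J ι π M θ) (liftBlk blk ι) (liftBlk (blk ∘ π) ι) hη.le hL.le hB₀
    (bgOpsM₁4 π ν G S D₃ D SD G' S' D₃' D' SD') U fun n => ?_
  have hdom : ∀ {B : ℝ}, 0 ≤ B → B ≤ B₀ → ∀ y y' : g.Site,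
      B * θ * Real.exp (-((δ - σ) * g.dist y y')) ≤
        B₀ * B9.pref4 ((opGeo g (X × ι) (liftBlk blk ι)).len y) n * Real.exp (-((δ - σ) * g.dist y y')) *
          max (rateFactor (opGeo g (X × ι) (liftBlk blk ι)) γ y) (rateFactor (opGeo g (X × ι) (liftBlk blk ι)) γ y') := by
    intro B hB0 hB y y'
    have hpref : 1 ≤ B9.pref4 ((opGeo g (X × ι) (liftBlk blk ι)).len y) n := by rw [opGeo_len]; exact one_le_pref4 (hlen y) n
    have hrf : θ ≤ max (rateFactor (opGeo g (X × ι) (liftBlk blk ι)) γ y) (rateFactor (opGeo g (X × ι) (liftBlk blk ι)) γ y') := by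
      rw [rateFactor_opGeo g (X × ι) (liftBlk blk ι) hη.ne' hL γ y']
      exact (hθγ y').trans (le_max_right _ _)
    have hE : 0 ≤ Real.exp (-((δ - σ) * g.dist y y')) := Real.exp_nonneg _
    calc B * θ * Real.exp (-((δ - σ) * g.dist y y'))
        ≤ (B₀ * B9.pref4 ((opGeo g (X × ι) (liftBlk blk ι)).len y) n) * θ * Real.exp (-((δ - σ) * g.dist y y')) := by
          refine mul_le_mul_of_nonneg_right (mul_le_mul_of_nonneg_right ?_ hθ) hE
          calc B = B * 1 := (mul_one B).symm
            _ ≤ _ := mul_le_mul hB hpref zero_le_one hB₀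
      _ = B₀ * B9.pref4 ((opGeo g (X × ι) (liftBlk blk ι)).len y) n * Real.exp (-((δ - σ) * g.dist y y')) * θ := by ring
      _ ≤ _ := mul_le_mul_of_nonneg_left hrf (mul_nonneg (mul_nonneg hB₀ (zero_le_one.trans hpref)) hE)
  fin_cases n
  · exact (h01 none).mono (hdom hC0 (le_add_of_nonneg_right hC1))
  · exact (h01 (some ν)).mono (hdom hC0 (le_add_of_nonneg_right hC1))
  · have h2p := hasMaj_projO_comp (liftBlk (blk ∘ π) ι) h2 none
    have hcomp : idef (pull (liftMap π ι)) (pull (liftMap π ι)) (projO none ∘ₗ bgSourceV (stack G' D') (stack S' SD') (unstackM U.1 U.2))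
        (projO none ∘ₗ bgSourceV (stack G D) (stack S SD) (unstackM (avgM₁ J ι π U).1 (avgM₁ J ι π U).2)) =
        projO none ∘ₗ idef (pull (liftMap π ι)) (pull (liftPair (liftMap π ι))) (bgSourceV (stack G' D') (stack S' SD') (unstackM U.1 U.2))
          (bgSourceV (stack G D) (stack S SD) (unstackM (avgM₁ J ι π U).1 (avgM₁ J ι π U).2)) :=
      LinearMap.ext fun v => funext fun x' => rfl
    have h2' := (show HasMaj (BlockNorm.ofBlocks g (liftBlk blk ι)) (BlockNorm.ofBlocks g (liftBlk (blk ∘ π) ι)) _ _ from hcomp ▸ h2p)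
    exact h2'.mono (hdom hC0 (le_add_of_nonneg_right hC1))
  · exact h3.mono (hdom hC1 (le_add_of_nonneg_left hC0))

end Readout
section Node

variable {I J ι : Type} [Fintype J] [DecidableEq J] [Fintype ι] [DecidableEq ι] [Nonempty ι] (g : I → B6.Geometry) (X X' : I → Type)
  [∀ i, Fintype (X i)] [∀ i, Fintype (X' i)] [∀ i, DecidableEq (X i)] [∀ i, DecidableEq (X' i)] (blk : ∀ i, X i → (g i).Site) (π : ∀ i, X' i → X i)
  (nsh : I → ℕ) (hL0 : ∀ i, (g i).L ≠ 0) (θc θ : I → ℝ) (ν : I → J) (G S D₃ : ∀ i, (X i × ι → ℝ) →ₗ[ℝ] (X i × ι → ℝ))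
  (D SD : ∀ i, J → (X i × ι → ℝ) →ₗ[ℝ] (X i × ι → ℝ)) (G' S' D₃' : ∀ i, (X' i × ι → ℝ) →ₗ[ℝ] (X' i × ι → ℝ))
  (D' SD' : ∀ i, J → (X' i × ι → ℝ) →ₗ[ℝ] (X' i × ι → ℝ))

/-- **NE2⁺, OPERATOR LAYER — `T4EtaRate.NE2PlusOperator` BY NAME, NON-ABELIAN FIRST-ORDER SPECIES, ALL FOUR ENTRIES CONSTRUCTED, ONLY THE `U ≡ 1` LAYER DISPLAYED.**
For ANY family with UNIFORM `U ≡ 1` letters on the product carriers — majorants `β·e^{−δd}` (`σ < δ`) of `G_i, (∇_μG)_i, (G∇*)_i, (∇_μG∇*)_i` (coarse) and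
`G′_i, (∇′_μG′)_i, (Δ′G′)_i` (fine); η-defects `m₀·θ_i·e^{−δd}` of the five pairs; `0 ≤ θ_i ≤ (L^j)^{−γ}`, `γ > 0`; carriers with (2.54), `d ≥ 0`, uniform (2.61),
`η, L > 0`, sites of size `≥ 1`; `c₃₅ > 0`, `ι` nonempty —: `NE2PlusOperator c₃₅ (bgInstanceM₁ …) (bgFamilyM₁4 …)`, `M₅ = 1`, `a₀ = (2c₃₅|ι|(1+|J|)(βc_r+1))⁻¹`,
`B₀ = bgConst(…) + bgConst1(…) + 1`, `δ₀ = δ − σ`; (3.35) CONSUMED on every entry of every matrix coefficient of `V = M_C + Σ_μ M_{A_μ}∘∇_μ`.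
[cite: Balaban1985BackgroundPropagators, Thm 3.1 p.397 (quantifier template); (3.35) p.396, (3.42) + (3.44) p.397, (3.50)–(3.52) p.400, (3.63)–(3.65) pp.402–403 (shapes, mechanism)] -/
theorem ne2PlusOperator_backgroundM₁4 (c35 : ℝ) (hc35 : 0 < c35)
    (htri : ∀ i, Triangle254 (g i)) (hd : ∀ i (a b : (g i).Site), 0 ≤ (g i).dist a b) {σ cr : ℝ} (hσ : 0 ≤ σ) (hcr : 0 ≤ cr)
    (hrow : ∀ i, RowSum (g i) σ cr) (hη : ∀ i, 0 < (g i).eta) (hL : ∀ i, 0 < (g i).L) (hlen : ∀ i y, 1 ≤ (g i).len y)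
    {δ β m₀ γ : ℝ} (hσδ : σ < δ) (hβ : 0 ≤ β) (hm₀ : 0 ≤ m₀) (hγ : 0 < γ) (hθ : ∀ i, 0 ≤ θ i) (hθγ : ∀ i y, θ i ≤ rateWeight (g i) γ y)
    (hG : ∀ i, HasMaj (BlockNorm.ofBlocks (g i) (liftBlk (blk i) ι)) (BlockNorm.ofBlocks (g i) (liftBlk (blk i) ι)) (G i)
      (fun y y' => β * Real.exp (-(δ * (g i).dist y y'))))
    (hD : ∀ i μ, HasMaj (BlockNorm.ofBlocks (g i) (liftBlk (blk i) ι)) (BlockNorm.ofBlocks (g i) (liftBlk (blk i) ι)) (D i μ)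
      (fun y y' => β * Real.exp (-(δ * (g i).dist y y'))))
    (hG' : ∀ i, HasMaj (BlockNorm.ofBlocks (g i) (liftBlk (blk i ∘ π i) ι)) (BlockNorm.ofBlocks (g i) (liftBlk (blk i ∘ π i) ι)) (G' i)
      (fun y y' => β * Real.exp (-(δ * (g i).dist y y'))))
    (hD' : ∀ i μ, HasMaj (BlockNorm.ofBlocks (g i) (liftBlk (blk i ∘ π i) ι)) (BlockNorm.ofBlocks (g i) (liftBlk (blk i ∘ π i) ι)) (D' i μ)
      (fun y y' => β * Real.exp (-(δ * (g i).dist y y'))))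
    (hS : ∀ i, HasMaj (BlockNorm.ofBlocks (g i) (liftBlk (blk i) ι)) (BlockNorm.ofBlocks (g i) (liftBlk (blk i) ι)) (S i)
      (fun y y' => β * Real.exp (-(δ * (g i).dist y y'))))
    (hSD : ∀ i μ, HasMaj (BlockNorm.ofBlocks (g i) (liftBlk (blk i) ι)) (BlockNorm.ofBlocks (g i) (liftBlk (blk i) ι)) (SD i μ)
      (fun y y' => β * Real.exp (-(δ * (g i).dist y y'))))
    (hD₃' : ∀ i, HasMaj (BlockNorm.ofBlocks (g i) (liftBlk (blk i ∘ π i) ι)) (BlockNorm.ofBlocks (g i) (liftBlk (blk i ∘ π i) ι)) (D₃' i)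
      (fun y y' => β * Real.exp (-(δ * (g i).dist y y'))))
    (hDG : ∀ i, HasMaj (BlockNorm.ofBlocks (g i) (liftBlk (blk i) ι)) (BlockNorm.ofBlocks (g i) (liftBlk (blk i ∘ π i) ι))
      (idef (pull (liftMap (π i) ι)) (pull (liftMap (π i) ι)) (G' i) (G i)) (fun y y' => m₀ * θ i * Real.exp (-(δ * (g i).dist y y'))))
    (hDD : ∀ i μ, HasMaj (BlockNorm.ofBlocks (g i) (liftBlk (blk i) ι)) (BlockNorm.ofBlocks (g i) (liftBlk (blk i ∘ π i) ι))
      (idef (pull (liftMap (π i) ι)) (pull (liftMap (π i) ι)) (D' i μ) (D i μ)) (fun y y' => m₀ * θ i * Real.exp (-(δ * (g i).dist y y'))))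
    (hDS : ∀ i, HasMaj (BlockNorm.ofBlocks (g i) (liftBlk (blk i) ι)) (BlockNorm.ofBlocks (g i) (liftBlk (blk i ∘ π i) ι))
      (idef (pull (liftMap (π i) ι)) (pull (liftMap (π i) ι)) (S' i) (S i)) (fun y y' => m₀ * θ i * Real.exp (-(δ * (g i).dist y y'))))
    (hDSD : ∀ i μ, HasMaj (BlockNorm.ofBlocks (g i) (liftBlk (blk i) ι)) (BlockNorm.ofBlocks (g i) (liftBlk (blk i ∘ π i) ι))
      (idef (pull (liftMap (π i) ι)) (pull (liftMap (π i) ι)) (SD' i μ) (SD i μ)) (fun y y' => m₀ * θ i * Real.exp (-(δ * (g i).dist y y'))))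
    (hDD₃ : ∀ i, HasMaj (BlockNorm.ofBlocks (g i) (liftBlk (blk i) ι)) (BlockNorm.ofBlocks (g i) (liftBlk (blk i ∘ π i) ι))
      (idef (pull (liftMap (π i) ι)) (pull (liftMap (π i) ι)) (D₃' i) (D₃ i)) (fun y y' => m₀ * θ i * Real.exp (-(δ * (g i).dist y y')))) :
    NE2PlusOperator c35 (fun i => bgInstanceM₁ J ι (blk i) (π i) (nsh i) (hL0 i) (θc i) (θ i))
      (fun i => bgFamilyM₁4 (blk i) (π i) (nsh i) (hL0 i) (θc i) (θ i) (ν i) (G i) (S i) (D₃ i) (D i) (SD i) (G' i) (S' i) (D₃' i) (D' i) (SD' i)) := by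
  have hι1 : (1 : ℝ) ≤ Fintype.card ι := by exact_mod_cast Fintype.card_pos
  have hJ1 : (1 : ℝ) ≤ 1 + Fintype.card J := le_add_of_nonneg_right (Nat.cast_nonneg _)
  have hcι : (0 : ℝ) < Fintype.card ι * (1 + Fintype.card J) := mul_pos (lt_of_lt_of_le one_pos hι1) (lt_of_lt_of_le one_pos hJ1)
  set a₀ : ℝ := (2 * (c35 * (Fintype.card ι * (1 + Fintype.card J))) * (β * cr + 1))⁻¹ with ha₀_def
  have hden : 0 < 2 * (c35 * (Fintype.card ι * (1 + Fintype.card J))) * (β * cr + 1) := by positivity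
  have ha₀ : 0 < a₀ := inv_pos.2 hden
  have hq : β * (c35 * (Fintype.card ι * (1 + Fintype.card J)) * a₀) * cr ≤ 1 / 2 := by
    have h1 : β * (c35 * (Fintype.card ι * (1 + Fintype.card J)) * a₀) * cr = (β * cr) * (c35 * (Fintype.card ι * (1 + Fintype.card J)) * a₀) := by
      ring
    have h2 : c35 * (Fintype.card ι * (1 + Fintype.card J)) * a₀ = (2 * (β * cr + 1))⁻¹ := by
      rw [ha₀_def]; field_simp
    rw [h1, h2, ← div_eq_mul_inv, div_le_iff₀ (by positivity)]
    nlinarith [mul_nonneg hβ hcr]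
  have hC0 : 0 ≤ bgConst β cr m₀ (c35 * (Fintype.card ι * (1 + Fintype.card J))) a₀ :=
    bgConst_nonneg hβ hcr hm₀ (mul_nonneg hc35.le hcι.le) ha₀.le
  have hC1 : 0 ≤ bgConst1 β cr m₀ (c35 * (Fintype.card ι * (1 + Fintype.card J))) a₀ :=
    bgConst1_nonneg hβ hcr hm₀ (mul_nonneg hc35.le hcι.le) ha₀.le
  refine ⟨1, δ - σ, a₀, bgConst β cr m₀ (c35 * (Fintype.card ι * (1 + Fintype.card J))) a₀ +
      bgConst1 β cr m₀ (c35 * (Fintype.card ι * (1 + Fintype.card J))) a₀ + 1, γ, one_pos, by linarith, ha₀, by linarith, hγ,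
    fun i hM α₀ hα₀ hMα U hreg => ?_⟩
  have hM' : 1 ≤ (g i).M := hM
  have hMα' : (g i).M * α₀ ≤ a₀ := hMα
  have key := etaRateIneq342_backgroundM₁4 (J := J) (ι := ι) (blk i) (π i) (htri i) (hd i) hσ hcr (hrow i) (hη i) (hL i) (hlen i) hσδ.le hβ hm₀
    (hθ i) (hθγ i) hc35 ha₀.le hq hM' hα₀ hMα' (ν := ν i) (hG i) (hD i) (hG' i) (hD' i) (hS i) (hSD i) (hD₃' i) (hDG i) (hDD i) (hDS i) (hDSD i)
    (hDD₃ i) hreg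
  intro n lam y y' hs
  refine (key n lam y y' hs).trans ?_
  have hpref : 0 ≤ B9.pref4 ((bgInstanceM₁ J ι (blk i) (π i) (nsh i) (hL0 i) (θc i) (θ i)).gc.len y) n := by
    have : 1 ≤ B9.pref4 ((opGeo (g i) (X i × ι) (liftBlk (blk i) ι)).len y) n := by rw [opGeo_len]; exact one_le_pref4 (hlen i y) n
    exact zero_le_one.trans this
  have hrf : 0 ≤ max (rateFactor (bgInstanceM₁ J ι (blk i) (π i) (nsh i) (hL0 i) (θc i) (θ i)).gc γ y)
      (rateFactor (bgInstanceM₁ J ι (blk i) (π i) (nsh i) (hL0 i) (θc i) (θ i)).gc γ y') :=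
    (T4EtaRate.rateFactor_nonneg (g := opGeo (g i) (X i × ι) (liftBlk (blk i) ι)) (hη i).le (hL i).le γ y).trans (le_max_left _ _)
  have hnorm : 0 ≤ (bgInstanceM₁ J ι (blk i) (π i) (nsh i) (hL0 i) (θc i) (θ i)).gc.supNorm lam := Real.iSup_nonneg fun x => abs_nonneg _
  have hE : 0 ≤ Real.exp (-((δ - σ) * (bgInstanceM₁ J ι (blk i) (π i) (nsh i) (hL0 i) (θc i) (θ i)).gc.dist y y')) := Real.exp_nonneg _
  exact mul_le_mul_of_nonneg_right (mul_le_mul_of_nonneg_right (mul_le_mul_of_nonneg_right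
    (mul_le_mul_of_nonneg_right (le_add_of_nonneg_right zero_le_one) hpref) hE) hrf) hnorm

end Node

end Summit.QuantumFields.YangMills.BalabanUVNodes.N15.BackgroundLayer
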